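import Mathlib.Analysis.Complex.ExponentialBounds
import Literature.NumberTheory.LFunctions.DeBruijnPhiLogConcave
import HarnessLib

/-!
# Envelopes of the logarithmic derivatives of the Pólya–de Bruijn kernel: `−Φ′/Φ` and `−(log Φ)″`

Topic `Literature/NumberTheory/LFunctions`; sequel of `DeBruijnPhiThetaTails.lean` (heads and tails of the theta series
of `Φ`, `Φ′`, `Φ″`: Coffey–Csordas 2013, Proposition 2.1 with proved constants) and `DeBruijnPhiLogConcave.lean`
(Theorem 2.4 in the quantitative form `Φ′² − ΦΦ″ > 16πe^{4|u|}Φ²`). Write `y = πe^{4u}` and, as in Coffey–Csordas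
(2.9)–(2.11), `Φ = a₁(1 + r)` with the first theta term `a₁(u) = eᵘe^{−y}y(2y − 3)`; then EXACTLY
`−a₁′/a₁ = 4y − 9 − 12/(2y − 3)` and `−(log a₁)″ = 16y + 96y/(2y − 3)²` ((2.8): `L/a₁² = 16y(4y² − 12y + 15)/(2y − 3)²`),
and the tails `r, r′, r″` are `O(y^k e^{−3y})`. This file turns these into the two-sided ENVELOPES of
`L := −Φ′/Φ` and the UPPER envelope of `V := (Φ′² − ΦΦ″)/Φ² = −(log Φ)″` that the Laplace / Brascamp–Lieb analysis of
the tilted laws `u^kΦ(u)du` consumes (the lower envelope `V > 16πe^{4|u|}` is `deBruijnPhi_logConcave_quantitative`):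

* `neg_deBruijnPhiDeriv_le` / `neg_deBruijnPhiDeriv_div_le`: `−Φ′(u) ≤ (4πe^{4u} − 9)·Φ(u)` for all `u ≥ 0`;
* `neg_deBruijnPhiDeriv_ge` / `le_neg_deBruijnPhiDeriv_div`: `(4πe^{4u} − 9.005)·Φ(u) ≤ −Φ′(u)` for `u ≥ 3/2`;
* `deBruijnPhi_logConcave_upper_global`: `Φ′² − ΦΦ″ ≤ (16y + 120y/(2y − 3)²)·Φ²` for all `u ≥ 0`;
* `deBruijnPhi_logConcave_upper`: `Φ′² − ΦΦ″ ≤ 16πe^{4u}(1 + 10⁻⁶)·Φ²` for `u ≥ 3/2` (and the `/Φ²` forms).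

Mechanism (`envelope_*_of_bounds`, pure algebra on the head/tail bounds, as in `discr_pos_of_bounds`): with the heads
`A₀ = (2y² − 3y)v`, `A₁ = (8y³ − 30y² + 15y)v` (`v = e^{−y}`), `A₁² − A₀A₂ = 16yA₀² + 96y³v²`, `|A₂| ≤ 32y⁴v` and the
tails `0 ≤ T₀ ≤ 32.04y²v⁴`, `0 ≤ T₁ ≤ 512.6y³v⁴`, `T₂ ≥ 0`: `(4y − 9)A₀ − A₁ = 12yv ≥ T₁`;
`A₁ − (4y − 9.005)A₀ = (0.01y² − 12.015y)v ≥ (4y − 9.005)T₀` once `y ≥ 1212`; and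
`(A₁ + T₁)² − (A₀ + T₀)(A₂ + T₂) ≤ 16yA₀² + 96y³v² + 9250·y³v²(yv)³ ≤ (16y + 120y/(2y − 3)²)A₀²`, resp.
`≤ 16y(1 + 10⁻⁶)A₀²` once `16·10⁻⁶(2y − 3)² ≥ 96.001`, i.e. `y ≥ 1230`; `u ≥ 3/2` gives `y ≥ πe⁶ > 1267`.

## References

* M. W. Coffey, G. Csordas, *On the log-concavity of a Jacobi theta function*, Math. Comp. 82 (2013) 2265–2272,
  Proposition 2.1 (tail bounds for `Φ₁ = Φ − a₁` and its derivatives), Lemma 2.2 and (2.8)–(2.11) (the head), proof of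
  Theorem 2.4. [CoffeyCsordas2013]
* G. Csordas, T. S. Norfolk, R. S. Varga, *The Riemann hypothesis and the Turán inequalities*, Trans. AMS 296 (1986),
  §3 ((3.7)–(3.12): envelopes of the same kind for `Φ` and `Φ′`). [CsordasNorfolkVarga1986]
-/

noncomputable section

open Filter Set
open scoped Real Topology

namespace Literature.NumberTheory.LFunctions

/-! ## 1. Numerics -/

/-- `ye^{−y} ≤ πe^{−π}` for `y ≥ π` (`te^{−t}` decreases on `[1, ∞)`). [folklore] -/
private theorem mul_exp_neg_le_pi' {y : ℝ} (hy : π ≤ y) : y * rexp (-y) ≤ π * rexp (-π) := by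
  have hπ := Real.pi_gt_three
  have h1 : y ≤ π * rexp (y - π) := by
    have h := Real.add_one_le_exp (y - π)
    nlinarith
  have h2 : rexp (y - π) * rexp (-(y - π)) = 1 := by rw [← Real.exp_add]; simp
  have h3 : rexp (-y) = rexp (-(y - π)) * rexp (-π) := by rw [← Real.exp_add]; congr 1; ring
  calc y * rexp (-y) = y * (rexp (-(y - π)) * rexp (-π)) := by rw [h3]
    _ ≤ (π * rexp (y - π)) * (rexp (-(y - π)) * rexp (-π)) := by gcongr
    _ = π * rexp (-π) * (rexp (y - π) * rexp (-(y - π))) := by ring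
    _ = π * rexp (-π) := by rw [h2, mul_one]

/-- `(πe^{−π})³ < 0.00257` and `(πe^{−π})² ≤ 0.01876`. [folklore] -/
private theorem pi_mul_exp_neg_pi_pow_bounds :
    (π * rexp (-π)) ^ 3 < 0.00257 ∧ (π * rexp (-π)) ^ 2 ≤ 0.01876 := by
  have h1 : π * rexp (-π) < 3.15 * (1 / 23) :=
    mul_lt_mul'' Real.pi_lt_d2 wintner_exp_neg_pi_lt Real.pi_pos.le (Real.exp_pos _).le
  have h0 : 0 ≤ π * rexp (-π) := by positivity
  constructor
  · calc (π * rexp (-π)) ^ 3 < (3.15 * (1 / 23)) ^ 3 := pow_lt_pow_left₀ h1 h0 (by norm_num)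
      _ ≤ 0.00257 := by norm_num
  · calc (π * rexp (-π)) ^ 2 ≤ (3.15 * (1 / 23)) ^ 2 := pow_le_pow_left₀ h0 h1.le 2
      _ ≤ 0.01876 := by norm_num

/-- `ye^{−y} ≤ 2/y` for `y > 0` (`e^y ≥ y²/2`). [folklore] -/
private theorem mul_exp_neg_le_two_div {y : ℝ} (hy : 0 < y) : y * rexp (-y) ≤ 2 / y := by
  have h := Real.quadratic_le_exp_of_nonneg hy.le
  have he : rexp (-y) = (rexp y)⁻¹ := Real.exp_neg y
  rw [he, le_div_iff₀ hy]
  have hexp : 0 < rexp y := Real.exp_pos y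
  calc y * (rexp y)⁻¹ * y = y ^ 2 / rexp y := by rw [div_eq_mul_inv]; ring
    _ ≤ 2 := by rw [div_le_iff₀ hexp]; nlinarith

/-- `πe⁶ > 1267.4` (`e > 2.7182818283`, `π > 3.141592`). [folklore] -/
private theorem pi_mul_exp_six_gt : 1267.4 < π * rexp 6 := by
  have he : (2.7182818283 : ℝ) ^ 6 < rexp 6 := by
    have h := Real.exp_one_gt_d9
    have : rexp 6 = rexp 1 ^ 6 := by rw [← Real.exp_nat_mul]; norm_num
    rw [this]
    exact pow_lt_pow_left₀ h (by norm_num) (by norm_num)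
  have h6 : (403.42 : ℝ) < rexp 6 := lt_trans (by norm_num) he
  nlinarith [Real.pi_gt_d6, Real.exp_pos (6 : ℝ)]

/-- For `u ≥ 3/2`: `πe^{4u} ≥ 1267.4`. [folklore] -/
private theorem pi_mul_exp_ge_of_ge {u : ℝ} (hu : 3 / 2 ≤ u) : 1267.4 ≤ π * rexp (4 * u) := by
  have h : rexp 6 ≤ rexp (4 * u) := Real.exp_le_exp.2 (by linarith)
  nlinarith [pi_mul_exp_six_gt, Real.pi_pos]

/-! ## 2. The algebra of the envelopes (heads `A_i`, tails `T_i` as in `DeBruijnPhiThetaTails.lean`) -/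

/-- **Upper envelope of `−Φ′/Φ`, algebraic core**: `A₁ + T₁ ≤ (4y − 9)(A₀ + T₀)`, because
`(4y − 9)A₀ − A₁ = 12y·v` dominates `T₁ ≤ 512.6·y³v⁴`. [cite: CoffeyCsordas2013, Proposition 2.1 (ii) and (2.9)–(2.10)] -/
theorem envelope_logDeriv_upper_of_bounds {y v A₀ A₁ T₀ T₁ : ℝ} (hy : π ≤ y) (hv0 : 0 < v)
    (hvle : v ≤ rexp (-π)) (hyv : y * v ≤ π * rexp (-π)) (hA₀ : A₀ = (2 * y ^ 2 - 3 * y) * v)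
    (hA₁ : A₁ = (8 * y ^ 3 - 30 * y ^ 2 + 15 * y) * v) (hT₀0 : 0 ≤ T₀)
    (hT₁le : T₁ ≤ 8 * (1000 / 999 * 4 ^ 3 * (y ^ 3 * (v * v ^ 3)))) :
    A₁ + T₁ ≤ (4 * y - 9) * (A₀ + T₀) := by
  have hπ := Real.pi_gt_three
  have hy0 : 0 < y := lt_of_lt_of_le Real.pi_pos hy
  have hv23 : v ≤ 1 / 23 := hvle.trans wintner_exp_neg_pi_lt.le
  have hyv0 : 0 ≤ y * v := by positivity
  have hw2 : (y * v) ^ 2 ≤ 0.01876 :=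
    (pow_le_pow_left₀ hyv0 hyv 2).trans pi_mul_exp_neg_pi_pow_bounds.2
  -- `T₁ ≤ 512.6·(y v)²·v·(y v) ≤ 12·y·v`
  have hT : T₁ ≤ 12 * y * v := by
    have h1 : 8 * (1000 / 999 * 4 ^ 3 * (y ^ 3 * (v * v ^ 3))) = (8 * (1000 / 999) * 64) * ((y * v) ^ 2 * v) * (y * v) := by
      ring
    have h2 : (y * v) ^ 2 * v ≤ 0.01876 * (1 / 23) := mul_le_mul hw2 hv23 hv0.le (by norm_num)
    have h3 : (8 * (1000 / 999) * 64 : ℝ) * ((y * v) ^ 2 * v) ≤ 12 := by nlinarith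
    calc T₁ ≤ (8 * (1000 / 999) * 64) * ((y * v) ^ 2 * v) * (y * v) := by rw [← h1]; exact hT₁le
      _ ≤ 12 * (y * v) := mul_le_mul_of_nonneg_right h3 hyv0
      _ = 12 * y * v := by ring
  have hkey : (4 * y - 9) * A₀ - A₁ = 12 * y * v := by rw [hA₀, hA₁]; ring
  have h49 : 0 ≤ (4 * y - 9) * T₀ := mul_nonneg (by linarith) hT₀0
  nlinarith

/-- **Lower envelope of `−Φ′/Φ`, algebraic core** (large `y`): `(4y − 9.005)(A₀ + T₀) ≤ A₁ + T₁` for `y ≥ 1212`,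
because `A₁ − (4y − 9.005)A₀ = (0.01y² − 12.015y)v` dominates `(4y − 9.005)T₀ ≤ 0.105·yv`.
[cite: CoffeyCsordas2013, Proposition 2.1 (i) and (2.9)–(2.10)] -/
theorem envelope_logDeriv_lower_of_bounds {y v A₀ A₁ T₀ T₁ : ℝ} (hy : 1212 ≤ y) (hv0 : 0 < v)
    (hvle : v ≤ rexp (-π)) (hyv : y * v ≤ π * rexp (-π)) (hA₀ : A₀ = (2 * y ^ 2 - 3 * y) * v)
    (hA₁ : A₁ = (8 * y ^ 3 - 30 * y ^ 2 + 15 * y) * v) (hT₀0 : 0 ≤ T₀) (hT₁0 : 0 ≤ T₁)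
    (hT₀le : T₀ ≤ 2 * (1000 / 999 * 4 ^ 2 * (y ^ 2 * (v * v ^ 3)))) :
    (4 * y - 9.005) * (A₀ + T₀) ≤ A₁ + T₁ := by
  have hy0 : 0 < y := by linarith
  have hv23 : v ≤ 1 / 23 := hvle.trans wintner_exp_neg_pi_lt.le
  have hyv0 : 0 ≤ y * v := by positivity
  have hw2 : (y * v) ^ 2 ≤ 0.01876 :=
    (pow_le_pow_left₀ hyv0 hyv 2).trans pi_mul_exp_neg_pi_pow_bounds.2
  have hkey : A₁ - (4 * y - 9.005) * A₀ = (0.01 * y ^ 2 - 12.015 * y) * v := by rw [hA₀, hA₁]; ring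
  -- `(4y − 9.005)T₀ ≤ 4y·T₀ ≤ 4·32.04·(y v)²·v·(y v) ≤ 0.105·y·v`
  have hT : (4 * y - 9.005) * T₀ ≤ 0.105 * y * v := by
    have h1 : (4 * y - 9.005) * T₀ ≤ 4 * y * T₀ := by nlinarith
    have h2 : 4 * y * (2 * (1000 / 999 * 4 ^ 2 * (y ^ 2 * (v * v ^ 3)))) =
        (4 * (2 * (1000 / 999) * 16)) * ((y * v) ^ 2 * v) * (y * v) := by ring
    have h3 : (y * v) ^ 2 * v ≤ 0.01876 * (1 / 23) := mul_le_mul hw2 hv23 hv0.le (by norm_num)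
    have h4 : (4 * (2 * (1000 / 999) * 16) : ℝ) * ((y * v) ^ 2 * v) ≤ 0.105 := by nlinarith
    calc (4 * y - 9.005) * T₀ ≤ 4 * y * T₀ := h1
      _ ≤ 4 * y * (2 * (1000 / 999 * 4 ^ 2 * (y ^ 2 * (v * v ^ 3)))) :=
          mul_le_mul_of_nonneg_left hT₀le (by positivity)
      _ = (4 * (2 * (1000 / 999) * 16)) * ((y * v) ^ 2 * v) * (y * v) := h2
      _ ≤ 0.105 * (y * v) := mul_le_mul_of_nonneg_right h4 hyv0
      _ = 0.105 * y * v := by ring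
  -- `(0.01y − 12.015)·y·v ≥ 0.105·y·v` since `y ≥ 1212`
  have hmain : 0.105 * y * v ≤ (0.01 * y ^ 2 - 12.015 * y) * v := by
    have : 0.105 * y ≤ 0.01 * y ^ 2 - 12.015 * y := by nlinarith
    nlinarith
  nlinarith

/-- **Upper envelope of `−(log Φ)″`, algebraic core**: with `E = y³v²`,
`(A₁ + T₁)² − (A₀ + T₀)(A₂ + T₂) ≤ 16y·A₀² + (96 + 9250·(yv)³)·E`.
[cite: CoffeyCsordas2013, Theorem 2.4 (proof) and Lemma 2.2 (2.8)] -/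
theorem envelope_logConcave_of_bounds {y v A₀ A₁ A₂ T₀ T₁ T₂ : ℝ} (hy : π ≤ y) (hv0 : 0 < v)
    (hvle : v ≤ rexp (-π)) (hA₀ : A₀ = (2 * y ^ 2 - 3 * y) * v)
    (hL : A₁ ^ 2 - A₀ * A₂ = 16 * y ^ 3 * (4 * y ^ 2 - 12 * y + 15) * v ^ 2)
    (hA₁le : |A₁| ≤ 8 * y ^ 3 * v) (hA₂le : |A₂| ≤ 32 * y ^ 4 * v)
    (hT₀0 : 0 ≤ T₀) (hT₁0 : 0 ≤ T₁) (hT₂0 : 0 ≤ T₂)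
    (hT₀le : T₀ ≤ 2 * (1000 / 999 * 4 ^ 2 * (y ^ 2 * (v * v ^ 3))))
    (hT₁le : T₁ ≤ 8 * (1000 / 999 * 4 ^ 3 * (y ^ 3 * (v * v ^ 3)))) :
    (A₁ + T₁) ^ 2 - (A₀ + T₀) * (A₂ + T₂) ≤
      16 * y * A₀ ^ 2 + (96 + 9250 * (y * v) ^ 3) * (y ^ 3 * v ^ 2) := by
  have hπ := Real.pi_gt_three
  have hypos : 0 < y := lt_of_lt_of_le Real.pi_pos hy
  have hy0 : 0 ≤ y := hypos.le
  have hv23 : v ≤ 1 / 23 := hvle.trans wintner_exp_neg_pi_lt.le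
  have hyv0 : 0 ≤ y * v := mul_nonneg hy0 hv0.le
  have hE0 : 0 < y ^ 3 * v ^ 2 := by positivity
  have hF0 : 0 ≤ y ^ 3 * v ^ 2 * (y * v) ^ 3 := by positivity
  -- head facts
  have hA₀0 : 0 ≤ A₀ := by rw [hA₀]; exact mul_nonneg (by nlinarith) hv0.le
  have hA₀le : A₀ ≤ 2 * y ^ 2 * v := by rw [hA₀]; exact mul_le_mul_of_nonneg_right (by nlinarith) hv0.le
  have hLeq : A₁ ^ 2 - A₀ * A₂ = 16 * y * A₀ ^ 2 + 96 * (y ^ 3 * v ^ 2) := by rw [hL, hA₀]; ring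
  have hEw : y ^ 6 * (v * v ^ 3) * v = y ^ 3 * v ^ 2 * (y * v) ^ 3 := by ring
  have hy3v : 0 ≤ 8 * y ^ 3 * v := by positivity
  have hy4v : 0 ≤ 32 * y ^ 4 * v := by positivity
  -- error terms
  have herr1 : |A₁| * T₁ ≤ 4101 * (y ^ 3 * v ^ 2 * (y * v) ^ 3) := by
    calc |A₁| * T₁ ≤ (8 * y ^ 3 * v) * (8 * (1000 / 999 * 4 ^ 3 * (y ^ 3 * (v * v ^ 3)))) :=
          mul_le_mul hA₁le hT₁le hT₁0 hy3v
      _ = (64 * (1000 / 999) * 64) * (y ^ 6 * (v * v ^ 3) * v) := by ring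
      _ ≤ 4101 * (y ^ 3 * v ^ 2 * (y * v) ^ 3) := by
          rw [hEw]; exact mul_le_mul_of_nonneg_right (by norm_num) hF0
  have herr3 : |A₂| * T₀ ≤ 1026 * (y ^ 3 * v ^ 2 * (y * v) ^ 3) := by
    calc |A₂| * T₀ ≤ (32 * y ^ 4 * v) * (2 * (1000 / 999 * 4 ^ 2 * (y ^ 2 * (v * v ^ 3)))) :=
          mul_le_mul hA₂le hT₀le hT₀0 hy4v
      _ = (64 * (1000 / 999) * 16) * (y ^ 6 * (v * v ^ 3) * v) := by ring
      _ ≤ 1026 * (y ^ 3 * v ^ 2 * (y * v) ^ 3) := by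
          rw [hEw]; exact mul_le_mul_of_nonneg_right (by norm_num) hF0
  have herrT : T₁ ^ 2 ≤ 22 * (y ^ 3 * v ^ 2 * (y * v) ^ 3) := by
    have hv3 : v ^ 3 ≤ 1 / 12167 := by
      calc v ^ 3 ≤ (1 / 23) ^ 3 := pow_le_pow_left₀ hv0.le hv23 3
        _ = 1 / 12167 := by norm_num
    have hc : (0 : ℝ) ≤ (8 * (1000 / 999) * 64) ^ 2 * (y ^ 3 * v ^ 2 * (y * v) ^ 3) :=
      mul_nonneg (by norm_num) hF0
    calc T₁ ^ 2 ≤ (8 * (1000 / 999 * 4 ^ 3 * (y ^ 3 * (v * v ^ 3)))) ^ 2 := pow_le_pow_left₀ hT₁0 hT₁le 2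
      _ = (8 * (1000 / 999) * 64) ^ 2 * (y ^ 6 * (v * v ^ 3) * v) * v ^ 3 := by ring
      _ ≤ (8 * (1000 / 999) * 64) ^ 2 * (y ^ 3 * v ^ 2 * (y * v) ^ 3) * (1 / 12167) := by
          rw [hEw]; exact mul_le_mul_of_nonneg_left hv3 hc
      _ = ((8 * (1000 / 999) * 64) ^ 2 * (1 / 12167)) * (y ^ 3 * v ^ 2 * (y * v) ^ 3) := by ring
      _ ≤ 22 * (y ^ 3 * v ^ 2 * (y * v) ^ 3) := mul_le_mul_of_nonneg_right (by norm_num) hF0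
  -- signs
  have e1 : A₁ * T₁ ≤ |A₁| * T₁ := mul_le_mul_of_nonneg_right (le_abs_self A₁) hT₁0
  have e3 : -(|A₂| * T₀) ≤ A₂ * T₀ := by
    have := mul_le_mul_of_nonneg_right (neg_abs_le A₂) hT₀0
    rwa [neg_mul] at this
  have e4 : 0 ≤ A₀ * T₂ := mul_nonneg hA₀0 hT₂0
  have e5 : 0 ≤ T₀ * T₂ := mul_nonneg hT₀0 hT₂0
  have expand : (A₁ + T₁) ^ 2 - (A₀ + T₀) * (A₂ + T₂) =
      (A₁ ^ 2 - A₀ * A₂) + 2 * (A₁ * T₁) + T₁ ^ 2 - A₀ * T₂ - A₂ * T₀ - T₀ * T₂ := by ring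
  set p₁ := A₁ * T₁ with hp₁
  set p₂ := A₀ * T₂ with hp₂
  set p₃ := A₂ * T₀ with hp₃
  set p₄ := T₀ * T₂ with hp₄
  set q₁ := |A₁| * T₁ with hq₁
  set q₃ := |A₂| * T₀ with hq₃
  set LL := A₁ ^ 2 - A₀ * A₂ with hLL
  set F := y ^ 3 * v ^ 2 * (y * v) ^ 3 with hF
  set E := y ^ 3 * v ^ 2 with hE
  set S := T₁ ^ 2 with hS
  set W := (y * v) ^ 3 with hW
  have hFE : F = E * W := by rw [hF, hE, hW]
  have hRHS : 16 * y * A₀ ^ 2 + (96 + 9250 * W) * E = 16 * y * A₀ ^ 2 + 96 * E + 9250 * F := by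
    rw [hFE]; ring
  rw [hRHS]
  linarith [expand, hLeq, e1, herr1, e3, herr3, herrT, e4, e5]

/-! ## 3. The envelopes of `L = −Φ′/Φ` -/

/-- The head of the series of `Φ′` in closed form: `A₁ = (8y³ − 30y² + 15y)e^{−y}`, `y = πx`.
[cite: CoffeyCsordas2013, (2.10)] -/
theorem phiPolyTerm_zero_P1_eq (x : ℝ) :
    phiPolyTerm 15 (-30) 8 0 x 0 = (8 * (π * x) ^ 3 - 30 * (π * x) ^ 2 + 15 * (π * x)) * rexp (-(π * x)) := by
  simp only [phiPolyTerm, thetaFreq]; push_cast; ring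

/-- The head of the series of `Φ` in closed form: `A₀ = (2y² − 3y)e^{−y}`. [cite: CoffeyCsordas2013, (2.9)] -/
theorem phiPolyTerm_zero_P0_eq (x : ℝ) :
    phiPolyTerm (-3) 2 0 0 x 0 = (2 * (π * x) ^ 2 - 3 * (π * x)) * rexp (-(π * x)) := by
  simp only [phiPolyTerm, thetaFreq]; push_cast; ring

/-- `e^{−4y} = e^{−y}·(e^{−y})³`. [folklore] -/
private theorem exp_neg_four_mul_eq (y : ℝ) : rexp (-(4 * y)) = rexp (-y) * rexp (-y) ^ 3 := by
  rw [← Real.exp_nat_mul, ← Real.exp_add]; congr 1; push_cast; ring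

/-- **Series form of the upper envelope**: for `x ≥ 1`, `Σ₁ ≤ (4πx − 9)·Σ₀` for the one-series sums of `−Φ′/eᵘ` and
`Φ/eᵘ`. [cite: CoffeyCsordas2013, Proposition 2.1 and (2.9)–(2.10)] -/
theorem tsum_phiPolyTerm_P1_le {x : ℝ} (hx : 1 ≤ x) :
    ∑' n, phiPolyTerm 15 (-30) 8 0 x n ≤ (4 * (π * x) - 9) * ∑' n, phiPolyTerm (-3) 2 0 0 x n := by
  have hx0 : 0 < x := by linarith
  have hπ := Real.pi_gt_three
  rw [(summable_phiPolyTerm (-3) 2 0 0 hx0).tsum_eq_zero_add, (summable_phiPolyTerm 15 (-30) 8 0 hx0).tsum_eq_zero_add]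
  have hy1 : π ≤ π * x := by nlinarith [Real.pi_pos]
  obtain ⟨hT₀0, -⟩ := tsum_phiPolyTerm_P0_succ_bounds hx
  obtain ⟨-, hT₁le⟩ := tsum_phiPolyTerm_P1_succ_bounds hx
  rw [exp_neg_four_mul_eq] at hT₁le
  exact envelope_logDeriv_upper_of_bounds hy1 (Real.exp_pos _) (Real.exp_le_exp.2 (by linarith))
    (mul_exp_neg_le_pi' hy1) (phiPolyTerm_zero_P0_eq x) (phiPolyTerm_zero_P1_eq x) hT₀0 hT₁le

/-- **Series form of the lower envelope**: for `πx ≥ 1212`, `(4πx − 9.005)·Σ₀ ≤ Σ₁`.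
[cite: CoffeyCsordas2013, Proposition 2.1 and (2.9)–(2.10)] -/
theorem le_tsum_phiPolyTerm_P1 {x : ℝ} (hx : 1 ≤ x) (hy : 1212 ≤ π * x) :
    (4 * (π * x) - 9.005) * ∑' n, phiPolyTerm (-3) 2 0 0 x n ≤ ∑' n, phiPolyTerm 15 (-30) 8 0 x n := by
  have hx0 : 0 < x := by linarith
  have hπ := Real.pi_gt_three
  rw [(summable_phiPolyTerm (-3) 2 0 0 hx0).tsum_eq_zero_add, (summable_phiPolyTerm 15 (-30) 8 0 hx0).tsum_eq_zero_add]
  have hy1 : π ≤ π * x := by nlinarith [Real.pi_pos]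
  obtain ⟨hT₀0, hT₀le⟩ := tsum_phiPolyTerm_P0_succ_bounds hx
  obtain ⟨hT₁0, -⟩ := tsum_phiPolyTerm_P1_succ_bounds hx
  rw [exp_neg_four_mul_eq] at hT₀le
  exact envelope_logDeriv_lower_of_bounds hy (Real.exp_pos _) (Real.exp_le_exp.2 (by linarith))
    (mul_exp_neg_le_pi' hy1) (phiPolyTerm_zero_P0_eq x) (phiPolyTerm_zero_P1_eq x) hT₀0 hT₁0 hT₀le

/-- **Upper envelope of `−Φ′/Φ` (all `u ≥ 0`)**: `−Φ′(u) ≤ (4πe^{4u} − 9)·Φ(u)` — the leading behaviour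
`−a₁′/a₁ = 4y − 9 − 12/(2y − 3)` of the first theta term, the `−12/(2y − 3)` absorbing the tails.
[cite: CoffeyCsordas2013, Proposition 2.1 and (2.9)–(2.10)] -/
theorem neg_deBruijnPhiDeriv_le {u : ℝ} (hu : 0 ≤ u) :
    -deBruijnPhiDeriv u ≤ (4 * π * rexp (4 * u) - 9) * deBruijnPhi u := by
  have hx1 : 1 ≤ rexp (4 * u) := Real.one_le_exp (by linarith)
  rw [deBruijnPhiDeriv_eq_tsum, deBruijnPhi_eq_tsum, neg_neg]
  have h := tsum_phiPolyTerm_P1_le hx1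
  have he : 0 < rexp u := Real.exp_pos u
  calc rexp u * ∑' n, phiPolyTerm 15 (-30) 8 0 (rexp (4 * u)) n
      ≤ rexp u * ((4 * (π * rexp (4 * u)) - 9) * ∑' n, phiPolyTerm (-3) 2 0 0 (rexp (4 * u)) n) :=
        mul_le_mul_of_nonneg_left h he.le
    _ = (4 * π * rexp (4 * u) - 9) * (rexp u * ∑' n, phiPolyTerm (-3) 2 0 0 (rexp (4 * u)) n) := by ring

/-- Ratio form: `−Φ′(u)/Φ(u) ≤ 4πe^{4u} − 9` for `u ≥ 0`. [cite: CoffeyCsordas2013, Proposition 2.1 and (2.9)–(2.10)] -/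
theorem neg_deBruijnPhiDeriv_div_le {u : ℝ} (hu : 0 ≤ u) :
    -deBruijnPhiDeriv u / deBruijnPhi u ≤ 4 * π * rexp (4 * u) - 9 := by
  rw [div_le_iff₀ (deBruijnPhi_pos_holds u)]
  exact neg_deBruijnPhiDeriv_le hu

/-- **Lower envelope of `−Φ′/Φ` (`u ≥ 3/2`)**: `(4πe^{4u} − 9.005)·Φ(u) ≤ −Φ′(u)` (`12/(2y − 3) < 0.005` for
`y = πe^{4u} ≥ πe⁶ > 1267`). [cite: CoffeyCsordas2013, Proposition 2.1 and (2.9)–(2.10)] -/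
theorem neg_deBruijnPhiDeriv_ge {u : ℝ} (hu : 3 / 2 ≤ u) :
    (4 * π * rexp (4 * u) - 9.005) * deBruijnPhi u ≤ -deBruijnPhiDeriv u := by
  have hx1 : 1 ≤ rexp (4 * u) := Real.one_le_exp (by linarith)
  have hy : 1212 ≤ π * rexp (4 * u) := le_trans (by norm_num) (pi_mul_exp_ge_of_ge hu)
  rw [deBruijnPhiDeriv_eq_tsum, deBruijnPhi_eq_tsum, neg_neg]
  have h := le_tsum_phiPolyTerm_P1 hx1 hy
  have he : 0 < rexp u := Real.exp_pos u
  calc (4 * π * rexp (4 * u) - 9.005) * (rexp u * ∑' n, phiPolyTerm (-3) 2 0 0 (rexp (4 * u)) n)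
      = rexp u * ((4 * (π * rexp (4 * u)) - 9.005) * ∑' n, phiPolyTerm (-3) 2 0 0 (rexp (4 * u)) n) := by ring
    _ ≤ rexp u * ∑' n, phiPolyTerm 15 (-30) 8 0 (rexp (4 * u)) n := mul_le_mul_of_nonneg_left h he.le

/-- Ratio form: `4πe^{4u} − 9.005 ≤ −Φ′(u)/Φ(u)` for `u ≥ 3/2`. [cite: CoffeyCsordas2013, Proposition 2.1 and (2.9)–(2.10)] -/
theorem le_neg_deBruijnPhiDeriv_div {u : ℝ} (hu : 3 / 2 ≤ u) :
    4 * π * rexp (4 * u) - 9.005 ≤ -deBruijnPhiDeriv u / deBruijnPhi u := by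
  rw [le_div_iff₀ (deBruijnPhi_pos_holds u)]
  exact neg_deBruijnPhiDeriv_ge hu

/-! ## 4. The upper envelope of `V = (Φ′² − ΦΦ″)/Φ² = −(log Φ)″` -/

/-- **Series form of the upper envelope of the discriminant**: for `x ≥ 1` and `y = πx`,
`Σ₁² − Σ₀Σ₂ ≤ 16y·A₀² + (96 + 9250(ye^{−y})³)·y³e^{−2y}` where `A₀ = (2y² − 3y)e^{−y}` is the head of `Σ₀`.
[cite: CoffeyCsordas2013, Theorem 2.4 (proof) and Lemma 2.2 (2.8)] -/
theorem tsum_phiPolyTerm_discr_le {x : ℝ} (hx : 1 ≤ x) :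
    (∑' n, phiPolyTerm 15 (-30) 8 0 x n) ^ 2 -
        (∑' n, phiPolyTerm (-3) 2 0 0 x n) * (∑' n, phiPolyTerm (-75) 330 (-224) 32 x n) ≤
      16 * (π * x) * phiPolyTerm (-3) 2 0 0 x 0 ^ 2 +
        (96 + 9250 * ((π * x) * rexp (-(π * x))) ^ 3) * ((π * x) ^ 3 * rexp (-(π * x)) ^ 2) := by
  have hx0 : 0 < x := by linarith
  have hπ := Real.pi_gt_three
  rw [(summable_phiPolyTerm (-3) 2 0 0 hx0).tsum_eq_zero_add,
    (summable_phiPolyTerm (-75) 330 (-224) 32 hx0).tsum_eq_zero_add,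
    (summable_phiPolyTerm 15 (-30) 8 0 hx0).tsum_eq_zero_add]
  have hy1 : π ≤ π * x := by nlinarith [Real.pi_pos]
  obtain ⟨hT₀0, hT₀le⟩ := tsum_phiPolyTerm_P0_succ_bounds hx
  obtain ⟨hT₁0, hT₁le⟩ := tsum_phiPolyTerm_P1_succ_bounds hx
  obtain ⟨hT₂0, -⟩ := tsum_phiPolyTerm_P2_succ_bounds hx
  rw [exp_neg_four_mul_eq] at hT₀le hT₁le
  exact envelope_logConcave_of_bounds hy1 (Real.exp_pos _) (Real.exp_le_exp.2 (by linarith))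
    (phiPolyTerm_zero_P0_eq x) (phiPolyTerm_head_discr x) (abs_phiPolyTerm_zero_P1_le hx)
    (abs_phiPolyTerm_zero_P2_le hx) hT₀0 hT₁0 hT₂0 hT₀le hT₁le

/-- `Σ₀ ≥ A₀ ≥ 0`: the one-series sum of `Φ/eᵘ` dominates its (nonnegative) head. [cite: CoffeyCsordas2013, Proposition 2.1 (i)] -/
theorem phiPolyTerm_zero_le_tsum {x : ℝ} (hx : 1 ≤ x) :
    0 ≤ phiPolyTerm (-3) 2 0 0 x 0 ∧ phiPolyTerm (-3) 2 0 0 x 0 ≤ ∑' n, phiPolyTerm (-3) 2 0 0 x n := by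
  have hx0 : 0 < x := by linarith
  refine ⟨(phiPolyTerm_zero_P0_bounds hx).1, ?_⟩
  rw [(summable_phiPolyTerm (-3) 2 0 0 hx0).tsum_eq_zero_add]
  linarith [(tsum_phiPolyTerm_P0_succ_bounds hx).1]

/-- **Global upper envelope of `−(log Φ)″`**: for every `u ≥ 0`, with `y = πe^{4u}`,
`Φ′(u)² − Φ(u)Φ″(u) ≤ (16y + 120y/(2y − 3)²)·Φ(u)²` (the exact `−(log a₁)″ = 16y + 96y/(2y − 3)²` of the first theta
term plus `≤ 24y/(2y − 3)²` for the tails). [cite: CoffeyCsordas2013, Theorem 2.4 (proof) and (2.8)] -/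
theorem deBruijnPhi_logConcave_upper_global {u : ℝ} (hu : 0 ≤ u) :
    deBruijnPhiDeriv u ^ 2 - deBruijnPhi u * deBruijnPhiDeriv₂ u ≤
      (16 * (π * rexp (4 * u)) + 120 * (π * rexp (4 * u)) / (2 * (π * rexp (4 * u)) - 3) ^ 2) *
        deBruijnPhi u ^ 2 := by
  have hx1 : 1 ≤ rexp (4 * u) := Real.one_le_exp (by linarith)
  have hπ := Real.pi_gt_three
  set x := rexp (4 * u) with hxdef
  set y := π * x with hydef
  have hyπ : π ≤ y := by rw [hydef]; nlinarith [Real.pi_pos]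
  have hy0 : 0 < y := lt_of_lt_of_le Real.pi_pos hyπ
  have h23 : 0 < 2 * y - 3 := by linarith
  -- the series quantities
  have hdisc := tsum_phiPolyTerm_discr_le hx1
  obtain ⟨hA0, hAle⟩ := phiPolyTerm_zero_le_tsum hx1
  set S₀ := ∑' n, phiPolyTerm (-3) 2 0 0 x n with hS₀
  set S₁ := ∑' n, phiPolyTerm 15 (-30) 8 0 x n with hS₁
  set S₂ := ∑' n, phiPolyTerm (-75) 330 (-224) 32 x n with hS₂
  set A₀ := phiPolyTerm (-3) 2 0 0 x 0 with hA₀def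
  set v := rexp (-(π * x)) with hvdef
  have hv0 : 0 < v := Real.exp_pos _
  have hA₀eq : A₀ = (2 * y ^ 2 - 3 * y) * v := by rw [hA₀def, hydef, hvdef]; exact phiPolyTerm_zero_P0_eq x
  -- `(yv)³ ≤ 0.00257`
  have hyv : y * v ≤ π * rexp (-π) := by rw [hvdef, ← hydef]; exact mul_exp_neg_le_pi' hyπ
  have hyv0 : 0 ≤ y * v := by positivity
  have hw3 : (y * v) ^ 3 ≤ 0.00257 := (pow_le_pow_left₀ hyv0 hyv 3).trans pi_mul_exp_neg_pi_pow_bounds.1.le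
  -- `E = y³v² = y·A₀²/(2y−3)²`
  have hE : y ^ 3 * v ^ 2 = y / (2 * y - 3) ^ 2 * A₀ ^ 2 := by
    have h23' : (2 * y - 3) ^ 2 ≠ 0 := pow_ne_zero 2 h23.ne'
    rw [hA₀eq, div_mul_eq_mul_div, eq_div_iff h23']
    ring
  -- combine: `S₁² − S₀S₂ ≤ 16y A₀² + 120·E ≤ (16y + 120y/(2y−3)²)·S₀²`
  have h1 : S₁ ^ 2 - S₀ * S₂ ≤ 16 * y * A₀ ^ 2 + 120 * (y ^ 3 * v ^ 2) := by
    have hE0 : 0 ≤ y ^ 3 * v ^ 2 := by positivity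
    have : (96 + 9250 * (y * v) ^ 3) * (y ^ 3 * v ^ 2) ≤ 120 * (y ^ 3 * v ^ 2) :=
      mul_le_mul_of_nonneg_right (by nlinarith) hE0
    have hd : S₁ ^ 2 - S₀ * S₂ ≤ 16 * y * A₀ ^ 2 + (96 + 9250 * (y * v) ^ 3) * (y ^ 3 * v ^ 2) := by
      have := hdisc; rw [← hydef] at this; exact this
    linarith
  have h2 : A₀ ^ 2 ≤ S₀ ^ 2 := pow_le_pow_left₀ hA0 hAle 2
  have hcoef : 0 ≤ 16 * y + 120 * y / (2 * y - 3) ^ 2 := by positivity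
  have h3 : 16 * y * A₀ ^ 2 + 120 * (y ^ 3 * v ^ 2) = (16 * y + 120 * y / (2 * y - 3) ^ 2) * A₀ ^ 2 := by
    rw [hE]; ring
  -- back to `Φ`, `Φ′`, `Φ″`
  have eΦ : deBruijnPhi u = rexp u * S₀ := by rw [hS₀, hxdef]; exact deBruijnPhi_eq_tsum u
  have eΦ' : deBruijnPhiDeriv u = -(rexp u * S₁) := by rw [hS₁, hxdef]; exact deBruijnPhiDeriv_eq_tsum u
  have eΦ'' : deBruijnPhiDeriv₂ u = rexp u * S₂ := by rw [hS₂, hxdef]; exact deBruijnPhiDeriv₂_eq_tsum u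
  rw [eΦ, eΦ', eΦ'']
  have he2 : 0 ≤ rexp u ^ 2 := sq_nonneg _
  calc (-(rexp u * S₁)) ^ 2 - rexp u * S₀ * (rexp u * S₂) = rexp u ^ 2 * (S₁ ^ 2 - S₀ * S₂) := by ring
    _ ≤ rexp u ^ 2 * ((16 * y + 120 * y / (2 * y - 3) ^ 2) * A₀ ^ 2) := by
        refine mul_le_mul_of_nonneg_left ?_ he2; rw [← h3]; exact h1
    _ ≤ rexp u ^ 2 * ((16 * y + 120 * y / (2 * y - 3) ^ 2) * S₀ ^ 2) :=
        mul_le_mul_of_nonneg_left (mul_le_mul_of_nonneg_left h2 hcoef) he2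
    _ = (16 * y + 120 * y / (2 * y - 3) ^ 2) * (rexp u * S₀) ^ 2 := by ring

/-- **Upper envelope of `−(log Φ)″` for `u ≥ 3/2`**: `Φ′(u)² − Φ(u)Φ″(u) ≤ 16πe^{4u}·(1 + 10⁻⁶)·Φ(u)²`
(so, with `deBruijnPhi_logConcave_quantitative`, `16πe^{4u} < −(log Φ)″(u) ≤ 16πe^{4u}(1 + 10⁻⁶)` there).
[cite: CoffeyCsordas2013, Theorem 2.4 (proof) and (2.8)] -/
theorem deBruijnPhi_logConcave_upper {u : ℝ} (hu : 3 / 2 ≤ u) :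
    deBruijnPhiDeriv u ^ 2 - deBruijnPhi u * deBruijnPhiDeriv₂ u ≤
      16 * π * rexp (4 * u) * (1 + 1 / 10 ^ 6) * deBruijnPhi u ^ 2 := by
  have hx1 : 1 ≤ rexp (4 * u) := Real.one_le_exp (by linarith)
  have hπ := Real.pi_gt_three
  set x := rexp (4 * u) with hxdef
  set y := π * x with hydef
  have hybig : 1267.4 ≤ y := by rw [hydef, hxdef]; exact pi_mul_exp_ge_of_ge hu
  have hyπ : π ≤ y := le_trans (by linarith [Real.pi_lt_d2]) hybig
  have hy0 : 0 < y := by linarith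
  have hdisc := tsum_phiPolyTerm_discr_le hx1
  obtain ⟨hA0, hAle⟩ := phiPolyTerm_zero_le_tsum hx1
  set S₀ := ∑' n, phiPolyTerm (-3) 2 0 0 x n with hS₀
  set S₁ := ∑' n, phiPolyTerm 15 (-30) 8 0 x n with hS₁
  set S₂ := ∑' n, phiPolyTerm (-75) 330 (-224) 32 x n with hS₂
  set A₀ := phiPolyTerm (-3) 2 0 0 x 0 with hA₀def
  set v := rexp (-(π * x)) with hvdef
  have hv0 : 0 < v := Real.exp_pos _
  have hA₀eq : A₀ = (2 * y ^ 2 - 3 * y) * v := by rw [hA₀def, hydef, hvdef]; exact phiPolyTerm_zero_P0_eq x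
  -- `(yv)³ ≤ (2/y)³ ≤ 8/1267.4³`
  have hyv : y * v ≤ 2 / y := by rw [hvdef, ← hydef]; exact mul_exp_neg_le_two_div hy0
  have hyv0 : 0 ≤ y * v := by positivity
  have hw3 : (y * v) ^ 3 ≤ (2 / 1267.4) ^ 3 := by
    have h2y : 2 / y ≤ 2 / 1267.4 := div_le_div_of_nonneg_left (by norm_num) (by norm_num) hybig
    exact pow_le_pow_left₀ hyv0 (hyv.trans h2y) 3
  have hw3' : 9250 * (y * v) ^ 3 ≤ 0.001 := by
    have : (2 / 1267.4 : ℝ) ^ 3 ≤ 0.001 / 9250 := by norm_num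
    linarith [hw3.trans this]
  -- `E = y³v²`, `16·10⁻⁶·(2y−3)²·E ≥ 102.5·E ≥ (96 + 0.001)·E`
  have hE0 : 0 ≤ y ^ 3 * v ^ 2 := by positivity
  have hE : (1 / 10 ^ 6 : ℝ) * (16 * y) * A₀ ^ 2 = 16 / 10 ^ 6 * (2 * y - 3) ^ 2 * (y ^ 3 * v ^ 2) := by
    rw [hA₀eq]; ring
  have hbig : (96.001 : ℝ) ≤ 16 / 10 ^ 6 * (2 * y - 3) ^ 2 := by nlinarith
  have h1 : S₁ ^ 2 - S₀ * S₂ ≤ 16 * y * A₀ ^ 2 + (1 / 10 ^ 6 : ℝ) * (16 * y) * A₀ ^ 2 := by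
    have hd : S₁ ^ 2 - S₀ * S₂ ≤ 16 * y * A₀ ^ 2 + (96 + 9250 * (y * v) ^ 3) * (y ^ 3 * v ^ 2) := by
      have := hdisc; rw [← hydef] at this; exact this
    have : (96 + 9250 * (y * v) ^ 3) * (y ^ 3 * v ^ 2) ≤ 16 / 10 ^ 6 * (2 * y - 3) ^ 2 * (y ^ 3 * v ^ 2) :=
      mul_le_mul_of_nonneg_right (by linarith) hE0
    rw [hE]; linarith
  have h2 : A₀ ^ 2 ≤ S₀ ^ 2 := pow_le_pow_left₀ hA0 hAle 2
  have hcoef : 0 ≤ 16 * y * (1 + 1 / 10 ^ 6) := by positivity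
  have h3 : S₁ ^ 2 - S₀ * S₂ ≤ 16 * y * (1 + 1 / 10 ^ 6) * S₀ ^ 2 := by
    calc S₁ ^ 2 - S₀ * S₂ ≤ 16 * y * (1 + 1 / 10 ^ 6) * A₀ ^ 2 := by linarith
      _ ≤ 16 * y * (1 + 1 / 10 ^ 6) * S₀ ^ 2 := mul_le_mul_of_nonneg_left h2 hcoef
  have eΦ : deBruijnPhi u = rexp u * S₀ := by rw [hS₀, hxdef]; exact deBruijnPhi_eq_tsum u
  have eΦ' : deBruijnPhiDeriv u = -(rexp u * S₁) := by rw [hS₁, hxdef]; exact deBruijnPhiDeriv_eq_tsum u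
  have eΦ'' : deBruijnPhiDeriv₂ u = rexp u * S₂ := by rw [hS₂, hxdef]; exact deBruijnPhiDeriv₂_eq_tsum u
  rw [eΦ, eΦ', eΦ'']
  have he2 : 0 ≤ rexp u ^ 2 := sq_nonneg _
  calc (-(rexp u * S₁)) ^ 2 - rexp u * S₀ * (rexp u * S₂) = rexp u ^ 2 * (S₁ ^ 2 - S₀ * S₂) := by ring
    _ ≤ rexp u ^ 2 * (16 * y * (1 + 1 / 10 ^ 6) * S₀ ^ 2) := mul_le_mul_of_nonneg_left h3 he2
    _ = 16 * π * x * (1 + 1 / 10 ^ 6) * (rexp u * S₀) ^ 2 := by rw [hydef]; ring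

/-- Ratio form: `(Φ′² − ΦΦ″)/Φ² ≤ 16πe^{4u}(1 + 10⁻⁶)` for `u ≥ 3/2`. [cite: CoffeyCsordas2013, Theorem 2.4 (proof) and (2.8)] -/
theorem deBruijnPhi_logConcave_upper_div {u : ℝ} (hu : 3 / 2 ≤ u) :
    (deBruijnPhiDeriv u ^ 2 - deBruijnPhi u * deBruijnPhiDeriv₂ u) / deBruijnPhi u ^ 2 ≤
      16 * π * rexp (4 * u) * (1 + 1 / 10 ^ 6) := by
  rw [div_le_iff₀ (pow_pos (deBruijnPhi_pos_holds u) 2)]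
  exact deBruijnPhi_logConcave_upper hu

/-- Ratio form of the global bound: `(Φ′² − ΦΦ″)/Φ² ≤ 16y + 120y/(2y − 3)²`, `y = πe^{4u}`, for `u ≥ 0`.
[cite: CoffeyCsordas2013, Theorem 2.4 (proof) and (2.8)] -/
theorem deBruijnPhi_logConcave_upper_global_div {u : ℝ} (hu : 0 ≤ u) :
    (deBruijnPhiDeriv u ^ 2 - deBruijnPhi u * deBruijnPhiDeriv₂ u) / deBruijnPhi u ^ 2 ≤
      16 * (π * rexp (4 * u)) + 120 * (π * rexp (4 * u)) / (2 * (π * rexp (4 * u)) - 3) ^ 2 := by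
  rw [div_le_iff₀ (pow_pos (deBruijnPhi_pos_holds u) 2)]
  exact deBruijnPhi_logConcave_upper_global hu

/-! ## 5. Two numerical corollaries: `Φ(0) ≤ 0.45` and `V ≤ 20 400` on `[0, 3/2]` (Lemma E (iv), (v)) -/

/-- **`Φ(0) ≤ 0.45`** (head `(2π² − 3π)e^{−π} < 10.32/23` plus tail `≤ 32.04π²e^{−4π}`; true value `0.44669…`).
[cite: CoffeyCsordas2013, Proposition 2.1 (i) and (2.9)] -/
theorem deBruijnPhi_zero_le : deBruijnPhi 0 ≤ 0.45 := by
  have hπ := Real.pi_gt_d4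
  have hπ' := Real.pi_lt_d4
  have h := deBruijnPhi_eq_tsum 0
  rw [mul_zero, Real.exp_zero, one_mul] at h
  rw [h, (summable_phiPolyTerm (-3) 2 0 0 one_pos).tsum_eq_zero_add, phiPolyTerm_zero_P0_eq 1, mul_one]
  obtain ⟨-, hT₀le⟩ := tsum_phiPolyTerm_P0_succ_bounds (le_refl (1 : ℝ))
  rw [mul_one] at hT₀le
  have hv : rexp (-π) ≤ 1 / 23 := wintner_exp_neg_pi_lt.le
  have hv0 : 0 < rexp (-π) := Real.exp_pos _
  have hv4 : rexp (-(4 * π)) ≤ (1 / 23) ^ 4 := by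
    rw [show -(4 * π) = (4 : ℕ) * (-π) by push_cast; ring, Real.exp_nat_mul]
    exact pow_le_pow_left₀ hv0.le hv 4
  have hhead : (2 * π ^ 2 - 3 * π) * rexp (-π) ≤ 10.32 * (1 / 23) :=
    mul_le_mul (by nlinarith) hv hv0.le (by norm_num)
  have htail : 2 * (1000 / 999 * 4 ^ 2 * (π ^ 2 * rexp (-(4 * π)))) ≤ 2 * (1000 / 999 * 4 ^ 2 * (9.87 * (1 / 23) ^ 4)) := by
    have : π ^ 2 * rexp (-(4 * π)) ≤ 9.87 * (1 / 23) ^ 4 :=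
      mul_le_mul (by nlinarith) hv4 (Real.exp_pos _).le (by norm_num)
    nlinarith
  have hnum : (10.32 : ℝ) * (1 / 23) + 2 * (1000 / 999 * 4 ^ 2 * (9.87 * (1 / 23) ^ 4)) ≤ 0.45 := by norm_num
  linarith

/-- **`V ≤ 20 400` on `[0, 3/2]`** (Lemma E (v)): for `0 ≤ u ≤ 3/2`, `Φ′(u)² − Φ(u)Φ″(u) ≤ 20400·Φ(u)²`
(global bound with `y = πe^{4u} ≤ πe⁶ < 1267.5` and `120y/(2y − 3)² ≤ 40` for `y ≥ 3`).
[cite: CoffeyCsordas2013, Theorem 2.4 (proof) and (2.8)] -/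
theorem deBruijnPhi_logConcave_upper_small {u : ℝ} (hu0 : 0 ≤ u) (hu : u ≤ 3 / 2) :
    deBruijnPhiDeriv u ^ 2 - deBruijnPhi u * deBruijnPhiDeriv₂ u ≤ 20400 * deBruijnPhi u ^ 2 := by
  have h := deBruijnPhi_logConcave_upper_global hu0
  have hπ := Real.pi_gt_three
  set y := π * rexp (4 * u) with hy
  -- `π ≤ y ≤ π e⁶ < 1267.5`
  have hx1 : 1 ≤ rexp (4 * u) := Real.one_le_exp (by linarith)
  have hyπ : π ≤ y := by rw [hy]; nlinarith [Real.pi_pos]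
  have he6 : rexp (4 * u) ≤ rexp 6 := Real.exp_le_exp.2 (by linarith)
  have he6' : rexp 6 < 403.43 := by
    have h1 := Real.exp_one_lt_d9
    have : rexp 6 = rexp 1 ^ 6 := by rw [← Real.exp_nat_mul]; norm_num
    rw [this]
    calc rexp 1 ^ 6 < (2.7182818286 : ℝ) ^ 6 := pow_lt_pow_left₀ h1 (Real.exp_pos _).le (by norm_num)
      _ < 403.43 := by norm_num
  have hyle : y ≤ 1267.5 := by
    rw [hy]; nlinarith [Real.pi_lt_d4, Real.pi_pos, Real.exp_pos (4 * u)]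
  have h23 : 0 < 2 * y - 3 := by linarith
  have hfrac : 120 * y / (2 * y - 3) ^ 2 ≤ 40 := by
    rw [div_le_iff₀ (pow_pos h23 2)]
    nlinarith
  have hcoef : 16 * y + 120 * y / (2 * y - 3) ^ 2 ≤ 20400 := by linarith
  exact h.trans (mul_le_mul_of_nonneg_right hcoef (sq_nonneg _))

end Literature.NumberTheory.LFunctions

end
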